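import Summits.QuantumFields.YangMills.Theorems.ConvexGribovBodyBrascampLiebVacuumSCStubPlaquetteFloor
import Summits.QuantumFields.YangMills.Theorems.ConvexGribovBodyBrascampLiebVacuumSCStubGaugeAlgebra
import Summits.QuantumFields.YangMills.Theorems.ConvexGribovBodyBrascampLiebVacuumSCStubFloorAssembly

/-!
# Crux `BrascampLiebVacuumSC` (stmt-QuantumFields-16404), line `SketchIdeator1`: the gauge-fixed floor
# WITHOUT the leak stub, for groups all of whose involutions are central — part I (orbit functional)

Helper file of the line lead (`prover-line-stmt-QuantumFields-16404-c1-0`). The skeleton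
`Cruxes/BrascampLiebVacuumSC/Lines/SketchIdeator1.lean` derives the volume-uniform floor

`d(β) ≤ ∫ sup_{h ∈ argmin coul(U,·)} L⁻³ Σ_{j,y} ‖A^h_j(y)‖²_F dμ_{β,S}`   (`floorCore_of_stubs`)

from four stubs, one of which (`stub_leak`) is a genuinely non-perturbative statement about the minimal
lattice Coulomb gauge. This file proves the SAME conclusion — for every `β` and every torus `S ≥ 1` —
with NO gauge-fixed input at all, under the group-theoretic hypothesis

`(hJ) every g : G with g * g = 1 is central`

(true for `SU(2)`, where `g² = 1` forces `g = ±1`; false for `SU(n)`, `n ≥ 3`, `Sp(n)`, `n ≥ 2`,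
`Spin(n)`, `n ≥ 5`). The point: the anti-Hermitian part `A = ½(ρ(V) − ρ(V)ᴴ)` of a unitary `ρ(V)`
vanishes iff `ρ(V)² = 1` iff (faithfulness) `V² = 1`; under (hJ) such `V` are central, so a plaquette
all of whose four links have `A = 0` in SOME gauge has a CENTRAL holonomy. Hence the gauge-orbit
infimum `Q(U_p) = inf_{gauges of p} Σ_{ℓ ∈ p} ‖A(U^h_ℓ)‖²_F` — a continuous class function of the
holonomy — is positive off the centre, its one-link Haar average `σ = ∫ Q(g,1,1,1) dg` is `> 0`, and
the one-link freeing argument of `stub_plaquetteFloor` gives `E_μ[Q(U_p)] ≥ e^{−2|β|B} σ` for every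
time-zero spatial plaquette, uniformly in the volume. Since every minimiser `h` is in particular a
gauge, `Σ_ℓ ‖A^h_ℓ‖²_F ≥ ¼ Σ_p Q(U_p)` pointwise (each slice link lies in four slice plaquettes), and
the floor follows with `d = (3/4) e^{−2|β|B} σ`.

For general simply-connected simple `G` the single-plaquette orbit infimum vanishes identically
(e.g. every element of `SU(3)` is a product of four elements of `{1} ∪ class(diag(1,−1,−1))`), which is
why the line needs `stub_leak` there; this file isolates exactly what the leak stub is for.

Contents of THIS file (part I): `CentralInvolutions.oneLink_floor` (the freeing argument of
`stub_plaquetteFloor`, abstracted over the observable) and `CentralInvolutions.exists_plaquetteOrbitFunctional`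
(the orbit functional: invariance, continuity, positivity, one-link Haar floor). Part II
(`…FloorCentralInvolutions.lean`) assembles `floorCore_of_involutions_central`. Everything is proved;
no named facts.
-/

set_option autoImplicit false

open scoped BigOperators Topology Matrix
open Filter MeasureTheory ProbabilityTheory
open Literature.MathematicalPhysics.QuantumFieldTheory
open Summit.QuantumFields.YangMills.Cruxes.CovarianceBound.SupportWindow
  (froSq coulombF IsCoulMin gluon modeCov supCov wilson4)

noncomputable section

namespace Summit.QuantumFields.YangMills.Theorems.BrascampLiebVacuumSC

open scoped ENNReal
open Summit.QuantumFields.YangMills.Theorems.BrascampLiebVacuum.Negative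
open Summit.QuantumFields.YangMills.Theorems.BrascampLiebVacuumSC.Negative
open Summit.QuantumFields.YangMills.Cruxes.CovarianceBound.SupportWindow.SupMeasurable

namespace CentralInvolutions

/-! ### The one-link freeing argument, abstracted over the observable -/

/-- **One-link floor (abstract form of `stub_plaquetteFloor`).** Let `f ≥ 0` be a continuous
observable on the torus `(2S+1)⁴`, `l` a link, `B` a bound for the change of the Wilson action
under updates of `l`, and suppose the one-link Haar average of `f` in `l` is at least `σ` in every
background. Then `E_μ[f] ≥ e^{−|β|B} e^{−|β|B} σ` (free the link `l` against the Boltzmann comparison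
`e^{±|β|B}`, integrate it first by `lmarginal`; the comparison factors and `Z` cancel). [folklore] -/
theorem oneLink_floor {G : Type} [Group G] [TopologicalSpace G] [IsTopologicalGroup G]
    [CompactSpace G] [MeasurableSpace G] [BorelSpace G] (r : LatticeRep G) (β : ℝ) {S : ℕ}
    (l : Edge 4 (2 * S + 1)) {B : ℝ}
    (hB : ∀ (U : GaugeConfig 4 (2 * S + 1) G) (g : G),
      |wilsonAction r.ρ U - wilsonAction r.ρ (Function.update U l g)| ≤ B)
    {f : GaugeConfig 4 (2 * S + 1) G → ℝ} (hfc : Continuous f) (hf0 : ∀ U, 0 ≤ f U)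
    {M : ℝ} (hfM : ∀ U, f U ≤ M) {σ : ℝ}
    (hkey : ∀ x : GaugeConfig 4 (2 * S + 1) G,
      σ ≤ ∫ g, f (Function.update x l g) ∂haarProbability G) :
    Real.exp (-(|β| * B)) * Real.exp (-(|β| * B)) * σ ≤ ∫ U, f U ∂(wilson4 r β S) := by
  classical
  -- trivial when `σ ≤ 0`
  rcases le_or_gt σ 0 with hσ | hσ
  · have h1 : Real.exp (-(|β| * B)) * Real.exp (-(|β| * B)) * σ ≤ 0 :=
      mul_nonpos_of_nonneg_of_nonpos (by positivity) hσ
    exact h1.trans (integral_nonneg hf0)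
  set e : ℝ := Real.exp (-(|β| * B)) with he
  have he0 : 0 < e := Real.exp_pos _
  haveI : SecondCountableTopology G :=
    (r.continuous.isClosedEmbedding r.injective).isEmbedding.secondCountableTopology
  show e * e * σ ≤ ∫ U, f U ∂(wilsonMeasure (d := 4) (L := 2 * S + 1) r.ρ β)
  set μ := wilsonMeasure (d := 4) (L := 2 * S + 1) r.ρ β with hμ
  haveI hprob : IsProbabilityMeasure μ :=
    isProbabilityMeasure_wilsonMeasure (d := 4) (L := 2 * S + 1) r.ρ r.continuous β
  set π : Measure (GaugeConfig 4 (2 * S + 1) G) := Measure.pi fun _ => haarProbability G with hπ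
  set w : GaugeConfig 4 (2 * S + 1) G → ℝ := fun U => Real.exp (-β * wilsonAction r.ρ U) with hw
  set w₁ : GaugeConfig 4 (2 * S + 1) G → ℝ := fun U => w (Function.update U l 1) with hw₁
  have hfm : Measurable f := hfc.measurable
  have hwm : Measurable w := ((measurable_wilsonAction r.ρ r.continuous).const_mul _).exp
  have hw₁m : Measurable w₁ := hwm.comp measurable_update_left
  -- Boltzmann comparisons in both directions
  have hcmp1 : ∀ U, e * w₁ U ≤ w U := fun U =>
    exp_mul_le_of_abs_sub_le (hB U 1)
  have hcmp2 : ∀ U, e * w U ≤ w₁ U := fun U => by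
    have h := hB U 1
    rw [abs_sub_comm] at h
    exact exp_mul_le_of_abs_sub_le h
  -- the partition function
  set Z : ℝ≥0∞ := partitionFunction (d := 4) (L := 2 * S + 1) r.ρ β with hZ
  have hZeq : Z = ∫⁻ U, ENNReal.ofReal (w U) ∂π := by
    simp only [hZ, partitionFunction, wilsonWeight, withDensity_apply _ MeasurableSet.univ,
      Measure.restrict_univ, hπ, hw]
  have hZ1 : Z⁻¹ * Z = 1 := by
    have h1 : μ Set.univ = 1 := measure_univ
    rw [hμ, wilsonMeasure, Measure.smul_apply, smul_eq_mul] at h1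
    exact h1
  -- the expectation as a lintegral against product Haar measure
  have hμπ : μ = Z⁻¹ • π.withDensity (fun U => ENNReal.ofReal (w U)) := by
    simp only [hμ, wilsonMeasure, wilsonWeight, hZ, hπ, hw]
  have hvar : ∫ U, f U ∂μ = (∫⁻ U, ENNReal.ofReal (f U) ∂μ).toReal :=
    integral_eq_lintegral_of_nonneg_ae (Eventually.of_forall hf0) hfm.aestronglyMeasurable
  have hlin : ∫⁻ U, ENNReal.ofReal (f U) ∂μ =
      Z⁻¹ * ∫⁻ U, ENNReal.ofReal (w U) * ENNReal.ofReal (f U) ∂π := by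
    rw [hμπ, lintegral_smul_measure, lintegral_withDensity_eq_lintegral_mul _
      hwm.ennreal_ofReal hfm.ennreal_ofReal]
    rfl
  -- finiteness
  have hfin : ∫⁻ U, ENNReal.ofReal (f U) ∂μ ≠ ⊤ := by
    refine ne_top_of_le_ne_top (b := ∫⁻ _U, ENNReal.ofReal M ∂μ) ?_ ?_
    · rw [lintegral_const, measure_univ, mul_one]; exact ENNReal.ofReal_ne_top
    · exact lintegral_mono fun U => ENNReal.ofReal_le_ofReal (hfM U)
  -- MAIN CHAIN (product Haar): ∫ w f ≥ e · (e · Z · σ)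
  have hstep1 : ENNReal.ofReal e * ∫⁻ U, ENNReal.ofReal (w₁ U) * ENNReal.ofReal (f U) ∂π ≤
      ∫⁻ U, ENNReal.ofReal (w U) * ENNReal.ofReal (f U) ∂π := by
    rw [← lintegral_const_mul' _ _ ENNReal.ofReal_ne_top]
    refine lintegral_mono fun U => ?_
    rw [← mul_assoc, ← ENNReal.ofReal_mul he0.le]
    exact mul_le_mul_left (ENNReal.ofReal_le_ofReal (hcmp1 U)) _
  -- one-link marginal
  have hkey' : ∀ x : GaugeConfig 4 (2 * S + 1) G,
      ENNReal.ofReal (w₁ x) * ENNReal.ofReal σ ≤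
        ∫⁻ g, ENNReal.ofReal (w₁ (Function.update x l g)) *
          ENNReal.ofReal (f (Function.update x l g)) ∂haarProbability G := by
    intro x
    have hw₁u : ∀ g, w₁ (Function.update x l g) = w₁ x := fun g => by
      simp only [hw₁, Function.update_idem]
    simp_rw [hw₁u]
    rw [lintegral_const_mul' _ _ ENNReal.ofReal_ne_top]
    refine mul_le_mul_right ?_ _
    have hcont : Continuous fun g : G => f (Function.update x l g) :=
      hfc.comp (continuous_const.update l continuous_id)
    rw [← ofReal_integral_eq_lintegral_ofReal
      (hcont.integrable_of_hasCompactSupport (HasCompactSupport.of_compactSpace _))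
      (Eventually.of_forall fun g => hf0 _)]
    exact ENNReal.ofReal_le_ofReal (hkey x)
  have hstep2 : ∫⁻ U, ENNReal.ofReal (w₁ U) * ENNReal.ofReal σ ∂π ≤
      ∫⁻ U, ENNReal.ofReal (w₁ U) * ENNReal.ofReal (f U) ∂π := by
    have hΦm : Measurable fun U => ENNReal.ofReal (w₁ U) * ENNReal.ofReal (f U) :=
      hw₁m.ennreal_ofReal.mul hfm.ennreal_ofReal
    have hΨm : Measurable fun U => ENNReal.ofReal (w₁ U) * ENNReal.ofReal σ :=
      hw₁m.ennreal_ofReal.mul measurable_const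
    rw [hπ, lintegral_eq_lmarginal_univ (1 : GaugeConfig 4 (2 * S + 1) G),
      lintegral_eq_lmarginal_univ (1 : GaugeConfig 4 (2 * S + 1) G),
      ← Finset.sdiff_union_of_subset (Finset.subset_univ {l}),
      lmarginal_union _ _ hΨm Finset.sdiff_disjoint, lmarginal_union _ _ hΦm Finset.sdiff_disjoint]
    refine lmarginal_mono (fun x => ?_) _
    rw [lmarginal_singleton, lmarginal_singleton]
    have hw₁u : ∀ g, w₁ (Function.update x l g) = w₁ x := fun g => by
      simp only [hw₁, Function.update_idem]
    calc ∫⁻ g, ENNReal.ofReal (w₁ (Function.update x l g)) * ENNReal.ofReal σ ∂haarProbability G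
        = ENNReal.ofReal (w₁ x) * ENNReal.ofReal σ := by
          simp_rw [hw₁u]; rw [lintegral_const, measure_univ, mul_one]
      _ ≤ _ := hkey' x
  have hstep3 : ENNReal.ofReal e * Z ≤ ∫⁻ U, ENNReal.ofReal (w₁ U) ∂π := by
    rw [hZeq, ← lintegral_const_mul' _ _ ENNReal.ofReal_ne_top]
    refine lintegral_mono fun U => ?_
    rw [← ENNReal.ofReal_mul he0.le]
    exact ENNReal.ofReal_le_ofReal (hcmp2 U)
  -- assemble in ℝ≥0∞
  have hchain : ENNReal.ofReal e * (ENNReal.ofReal e * Z * ENNReal.ofReal σ) ≤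
      ∫⁻ U, ENNReal.ofReal (w U) * ENNReal.ofReal (f U) ∂π := by
    refine le_trans ?_ hstep1
    refine mul_le_mul_right ?_ _
    refine le_trans ?_ hstep2
    rw [lintegral_mul_const' _ _ ENNReal.ofReal_ne_top]
    exact mul_le_mul_left hstep3 _
  have hgoal : ENNReal.ofReal (e * e * σ) ≤ ∫⁻ U, ENNReal.ofReal (f U) ∂μ := by
    rw [hlin]
    calc ENNReal.ofReal (e * e * σ)
        = Z⁻¹ * (ENNReal.ofReal e * (ENNReal.ofReal e * Z * ENNReal.ofReal σ)) := by
          rw [ENNReal.ofReal_mul (by positivity), ENNReal.ofReal_mul he0.le]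
          calc ENNReal.ofReal e * ENNReal.ofReal e * ENNReal.ofReal σ
              = (Z⁻¹ * Z) * (ENNReal.ofReal e * ENNReal.ofReal e * ENNReal.ofReal σ) := by
                rw [hZ1, one_mul]
            _ = _ := by ring
      _ ≤ _ := mul_le_mul_right hchain _
  rw [hvar]
  exact (ENNReal.ofReal_le_iff_le_toReal hfin).1 hgoal

end CentralInvolutions

open CentralInvolutions

/-! ### The gauge-orbit infimum of the anti-Hermitian mass on one plaquette -/

/-- **The plaquette orbit functional.** For a compact simple `G` all of whose involutions are
central and a faithful unitary `r`, there are a continuous `Q : G⁴ → [0, 4N]` and `σ > 0` with: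
`Q(u) ≤ Σ_{ℓ ∈ p} ‖½(ρ(v_ℓ) − ρ(v_ℓ)ᴴ)‖²_F` for the links `v = (a u₁ b⁻¹, b u₂ c⁻¹, d u₃ c⁻¹, a u₄ d⁻¹)`
of `u` in ANY gauge `(a, b, c, d)` of the plaquette, and `σ ≤ ∫ Q(g, u₂, u₃, u₄) dg` for all
`u₂, u₃, u₄` (one-link Haar floor). Construction: `Q(u) = inf` over the gauge orbit of the
anti-Hermitian mass (continuous by compactness, invariant, a function of the holonomy
`u₁u₂u₃⁻¹u₄⁻¹` up to left translation, so its one-link average is the constant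
`σ = ∫ Q(g,1,1,1) dg`); `Q(g,1,1,1) = 0` forces, at a minimising gauge, four links with `ρ(v)`
Hermitian, i.e. `v² = 1`, hence central, hence `g` central — so `Q(·,1,1,1) > 0` at a
non-central `g` (which exists, `G` being non-abelian) and `σ > 0`. [folklore] -/
theorem exists_plaquetteOrbitFunctional :
    ∀ (G : Type) [Group G] [TopologicalSpace G] [IsTopologicalGroup G] [CompactSpace G]
    [MeasurableSpace G] [BorelSpace G], IsCompactSimpleLieGroup G →
    (∀ g : G, g * g = 1 → g ∈ Subgroup.center G) → ∀ r : LatticeRep G,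
    ∃ (Q : G × G × G × G → ℝ) (σ : ℝ), 0 < σ ∧ Continuous Q ∧ (∀ u, 0 ≤ Q u) ∧
      (∀ u, Q u ≤ 4 * r.N) ∧
      (∀ a b c d u₁ u₂ u₃ u₄ : G, Q (u₁, u₂, u₃, u₄) ≤
        froSq ((1 / 2 : ℂ) • (r.ρ (a * u₁ * b⁻¹) - (r.ρ (a * u₁ * b⁻¹))ᴴ)) +
        froSq ((1 / 2 : ℂ) • (r.ρ (b * u₂ * c⁻¹) - (r.ρ (b * u₂ * c⁻¹))ᴴ)) +
        froSq ((1 / 2 : ℂ) • (r.ρ (d * u₃ * c⁻¹) - (r.ρ (d * u₃ * c⁻¹))ᴴ)) +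
        froSq ((1 / 2 : ℂ) • (r.ρ (a * u₄ * d⁻¹) - (r.ρ (a * u₄ * d⁻¹))ᴴ))) ∧
      (∀ u₂ u₃ u₄ : G, σ ≤ ∫ g, Q (g, u₂, u₃, u₄) ∂haarProbability G) := by
  intro G _ _ _ _ _ _ hG hJ r
  classical
  -- the anti-Hermitian mass of a link value (an opaque local function with its equation)
  obtain ⟨asq, hasq⟩ : ∃ asq : G → ℝ, asq = fun g => froSq ((1 / 2 : ℂ) • (r.ρ g - (r.ρ g)ᴴ)) :=
    ⟨_, rfl⟩
  have hasq0 : ∀ g, 0 ≤ asq g := fun g => by rw [hasq]; exact froSq_nonneg _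
  have hasqc : Continuous asq := by
    rw [hasq]
    exact continuous_froSq.comp
      ((r.continuous.fun_sub r.continuous.matrix_conjTranspose).fun_const_smul (1 / 2 : ℂ))
  have hasqN : ∀ g, asq g ≤ r.N := fun g => by
    rw [hasq]
    exact (froSq_half_sub_conjTranspose_le _).trans
      (froSq_of_mem_unitaryGroup (r.mem_unitary _)).le
  have hasq_zero : ∀ g, asq g = 0 → g * g = 1 := by
    intro g hg
    rw [hasq] at hg
    have hM : (1 / 2 : ℂ) • (r.ρ g - (r.ρ g)ᴴ) = 0 := by
      ext a b
      have h1 : ∑ a', ∑ b', ‖((1 / 2 : ℂ) • (r.ρ g - (r.ρ g)ᴴ)) a' b'‖ ^ 2 = 0 := hg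
      have h2 := (Finset.sum_eq_zero_iff_of_nonneg (fun a' _ =>
        Finset.sum_nonneg fun b' _ => sq_nonneg _)).1 h1 a (Finset.mem_univ a)
      have h3 := (Finset.sum_eq_zero_iff_of_nonneg (fun b' _ => sq_nonneg _)).1 h2 b
        (Finset.mem_univ b)
      simpa using h3
    have hsub : r.ρ g - (r.ρ g)ᴴ = 0 := by
      rcases smul_eq_zero.1 hM with h | h
      · norm_num at h
      · exact h
    have hinv : r.ρ g = r.ρ g⁻¹ := by
      rw [GaugeAlgebra.map_inv_eq_conjTranspose]; exact sub_eq_zero.1 hsub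
    have hg' : g = g⁻¹ := r.injective hinv
    exact mul_eq_one_iff_eq_inv.2 hg'
  -- the gauge action on the four links of a plaquette and the orbit functional (opaque)
  obtain ⟨act, hact⟩ : ∃ act : G × G × G × G → G × G × G × G → G × G × G × G,
      act = fun k u => (k.1 * u.1 * k.2.1⁻¹, k.2.1 * u.2.1 * k.2.2.1⁻¹,
        k.2.2.2 * u.2.2.1 * k.2.2.1⁻¹, k.1 * u.2.2.2 * k.2.2.2⁻¹) := ⟨_, rfl⟩
  obtain ⟨ψ, hψ⟩ : ∃ ψ : G × G × G × G → G × G × G × G → ℝ,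
      ψ = fun k u => asq (act k u).1 + asq (act k u).2.1 + asq (act k u).2.2.1 +
        asq (act k u).2.2.2 := ⟨_, rfl⟩
  obtain ⟨Q, hQ⟩ : ∃ Q : G × G × G × G → ℝ, Q = fun u => ⨅ k, ψ k u := ⟨_, rfl⟩
  have hactc : Continuous fun q : (G × G × G × G) × (G × G × G × G) => act q.1 q.2 := by
    rw [hact]; fun_prop
  have hψc : Continuous fun q : (G × G × G × G) × (G × G × G × G) => ψ q.1 q.2 := by
    rw [hψ]
    exact (((hasqc.comp (continuous_fst.comp hactc)).add
      (hasqc.comp (continuous_fst.comp (continuous_snd.comp hactc)))).add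
      (hasqc.comp (continuous_fst.comp (continuous_snd.comp (continuous_snd.comp hactc))))).add
      (hasqc.comp (continuous_snd.comp (continuous_snd.comp (continuous_snd.comp hactc))))
  have hψ0 : ∀ k u, 0 ≤ ψ k u := fun k u => by
    rw [hψ]
    exact add_nonneg (add_nonneg (add_nonneg (hasq0 _) (hasq0 _)) (hasq0 _)) (hasq0 _)
  have hψN : ∀ k u, ψ k u ≤ 4 * r.N := fun k u => by
    have := hasqN (act k u).1; have := hasqN (act k u).2.1
    have := hasqN (act k u).2.2.1; have := hasqN (act k u).2.2.2
    rw [hψ]; dsimp only; linarith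
  have hbdd : ∀ u, BddBelow (Set.range fun k => ψ k u) := fun u =>
    ⟨0, by rintro _ ⟨k, rfl⟩; exact hψ0 k u⟩
  have hQle : ∀ k u, Q u ≤ ψ k u := fun k u => by rw [hQ]; exact ciInf_le (hbdd u) k
  have hQ0 : ∀ u, 0 ≤ Q u := fun u => by rw [hQ]; exact le_ciInf fun k => hψ0 k u
  have hQN : ∀ u, Q u ≤ 4 * r.N := fun u => (hQle 1 u).trans (hψN 1 u)
  -- invariance under the gauge action
  have hact_mul : ∀ k k' u, act k' (act k u) = act (k' * k) u := by
    intro k k' u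
    rw [hact]
    simp only [Prod.fst_mul, Prod.snd_mul, mul_inv_rev]
    refine Prod.ext ?_ (Prod.ext ?_ (Prod.ext ?_ ?_)) <;> simp only [mul_assoc]
  have hQinv : ∀ k u, Q (act k u) = Q u := by
    intro k u
    have h1 : ∀ k', ψ k' (act k u) = ψ (k' * k) u := fun k' => by
      rw [hψ]; simp only [hact_mul]
    rw [hQ]
    simp only [h1]
    exact Equiv.iInf_comp (g := fun k'' => ψ k'' u) (Equiv.mulRight k)
  -- normal form: every single-plaquette configuration is a gauge of `(w g, 1, 1, 1)`
  have hQnf : ∀ g u₂ u₃ u₄ : G,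
      Q (g, u₂, u₃, u₄) = Q (u₂ * u₃⁻¹ * u₄⁻¹ * g, 1, 1, 1) := by
    intro g u₂ u₃ u₄
    have h1 : act (u₂ * u₃⁻¹ * u₄⁻¹, 1, u₂, u₂ * u₃⁻¹) (g, u₂, u₃, u₄) =
        (u₂ * u₃⁻¹ * u₄⁻¹ * g, 1, 1, 1) := by
      rw [hact]
      dsimp only
      refine Prod.ext ?_ (Prod.ext ?_ (Prod.ext ?_ ?_))
      · simp
      · simp
      · simp [mul_assoc]
      · simp [mul_assoc]
    rw [← h1, hQinv]
  -- continuity (Berge / compactness)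
  have hQc : Continuous Q := by
    have hQ' : Q = fun u => sInf ((fun k => ψ k u) '' Set.univ) := by
      rw [hQ]; funext u; rw [Set.image_univ, sInf_range]
    rw [hQ']
    exact IsCompact.continuous_sInf (f := fun u k => ψ k u) isCompact_univ
      (hψc.comp (continuous_snd.prodMk continuous_fst))
  -- positivity off the centre
  have hQpos : ∀ g : G, g ∉ Subgroup.center G → 0 < Q (g, 1, 1, 1) := by
    intro g hg
    by_contra hle
    have hQ0' : Q (g, 1, 1, 1) = 0 := le_antisymm (not_lt.1 hle) (hQ0 _)
    have hcont : Continuous fun k => ψ k (g, 1, 1, 1) :=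
      hψc.comp (continuous_id.prodMk continuous_const)
    obtain ⟨k, -, hk⟩ := isCompact_univ.exists_isMinOn Set.univ_nonempty hcont.continuousOn
    have hkQ : ψ k (g, 1, 1, 1) = 0 := by
      refine le_antisymm ?_ (hψ0 _ _)
      have h2 : ψ k (g, 1, 1, 1) ≤ Q (g, 1, 1, 1) := by
        rw [hQ]
        exact le_ciInf fun k' => hk (Set.mem_univ k')
      linarith
    -- the four links in the minimising gauge are involutions, hence central
    have h01 := hasq0 (act k (g, 1, 1, 1)).1
    have h02 := hasq0 (act k (g, 1, 1, 1)).2.1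
    have h03 := hasq0 (act k (g, 1, 1, 1)).2.2.1
    have h04 := hasq0 (act k (g, 1, 1, 1)).2.2.2
    have hsum : asq (act k (g, 1, 1, 1)).1 + asq (act k (g, 1, 1, 1)).2.1 +
        asq (act k (g, 1, 1, 1)).2.2.1 + asq (act k (g, 1, 1, 1)).2.2.2 = 0 := by
      rw [hψ] at hkQ; exact hkQ
    have e1 : asq (act k (g, 1, 1, 1)).1 = 0 := by linarith
    have e2 : asq (act k (g, 1, 1, 1)).2.1 = 0 := by linarith
    have e3 : asq (act k (g, 1, 1, 1)).2.2.1 = 0 := by linarith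
    have e4 : asq (act k (g, 1, 1, 1)).2.2.2 = 0 := by linarith
    obtain ⟨a, b, c, d⟩ := k
    rw [hact] at e1 e2 e3 e4
    simp only [mul_one] at e1 e2 e3 e4
    have c1 := hJ _ (hasq_zero _ e1)
    have c2 := hJ _ (hasq_zero _ e2)
    have c3 := hJ _ (hasq_zero _ e3)
    have c4 := hJ _ (hasq_zero _ e4)
    -- `g = c⁻¹ · [(d c⁻¹)⁻¹ (a d⁻¹)⁻¹ (a g b⁻¹) (b c⁻¹)] · c` and the bracket is central
    have hz : (d * c⁻¹)⁻¹ * (a * d⁻¹)⁻¹ * (a * g * b⁻¹) * (b * c⁻¹) ∈ Subgroup.center G :=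
      Subgroup.mul_mem _ (Subgroup.mul_mem _ (Subgroup.mul_mem _ (Subgroup.inv_mem _ c3)
        (Subgroup.inv_mem _ c4)) c1) c2
    have hgz : g = c⁻¹ * ((d * c⁻¹)⁻¹ * (a * d⁻¹)⁻¹ * (a * g * b⁻¹) * (b * c⁻¹)) * c := by group
    have hcomm := Subgroup.mem_center_iff.1 hz c
    apply hg
    rw [hgz, mul_assoc, ← hcomm, ← mul_assoc, inv_mul_cancel, one_mul]
    exact hz
  -- a non-central element exists (`G` is non-abelian)
  obtain ⟨g₀, hg₀⟩ : ∃ g₀ : G, g₀ ∉ Subgroup.center G := by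
    have hG' := hG.1
    unfold Literature.MathematicalPhysics.QuantumLattice.IsSimpleCompactGroup at hG'
    obtain ⟨-, ⟨a, b, hab⟩, -⟩ := hG'
    exact ⟨a, fun ha => hab ((Subgroup.mem_center_iff.1 ha b).symm)⟩
  -- the one-link Haar floor `σ`
  have hQ1c : Continuous fun g : G => Q (g, 1, 1, 1) :=
    hQc.comp (continuous_id.prodMk continuous_const)
  have hσpos : 0 < ∫ g, Q (g, 1, 1, 1) ∂haarProbability G := by
    have hint : Integrable (fun g : G => Q (g, 1, 1, 1)) (haarProbability G) :=
      hQ1c.integrable_of_hasCompactSupport (HasCompactSupport.of_compactSpace _)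
    rw [integral_pos_iff_support_of_nonneg (fun g => hQ0 _) hint]
    refine hQ1c.isOpen_support.measure_pos _ ⟨g₀, ?_⟩
    rw [Function.mem_support]
    exact (hQpos g₀ hg₀).ne'
  refine ⟨Q, ∫ g, Q (g, 1, 1, 1) ∂haarProbability G, hσpos, hQc, hQ0, hQN,
    fun a b c d u₁ u₂ u₃ u₄ => ?_, fun u₂ u₃ u₄ => ?_⟩
  · have h := hQle (a, b, c, d) (u₁, u₂, u₃, u₄)
    rw [hψ, hact, hasq] at h
    exact h
  · have h1 : (fun g => Q (g, u₂, u₃, u₄)) = fun g => Q (u₂ * u₃⁻¹ * u₄⁻¹ * g, 1, 1, 1) :=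
      funext fun g => hQnf g u₂ u₃ u₄
    rw [h1, integral_mul_left_eq_self (fun g => Q (g, 1, 1, 1)) (u₂ * u₃⁻¹ * u₄⁻¹)]

end Summit.QuantumFields.YangMills.Theorems.BrascampLiebVacuumSC

end
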